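import Literature.Barriers.CriticalPhenomena.PlaquetteWalkHoleRootWoundCostNS
import HarnessLib

/-!
# Barrier catalogue (SAWScalingLimit): VERTICAL runs of a Yang–Baxter walk keep their direction — the column twins of the run lemmas
(«COLUMN RUNS»)

The column twins of `PlaquetteWalkHoleRootWoundCostNS` §1 (`YBWalk.run_W/run_E`, `YBWalk.exists_run_start/end`, rows): for the
«RECTANGLE COEFFICIENT» classification (DESIGN-next b-engine-1 g24 §2bis (R2)–(R3): the vertical legs of a cost-`5` wound member, and
the extreme COLUMNS) one needs the same bookkeeping for arcs lying in one COLUMN.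

* `YBWalk.fc_pred_col_of_sIn_SN` / `YBWalk.fc_succ_col_of_sOut_SN`: an arc entered (left) through a slanted side has its predecessor
  (successor) in the same column; `YBWalk.sOut_SN_of_col_eq`: two consecutive arcs in one column are joined through a slanted side.
* ★ `YBWalk.run_N` / `YBWalk.run_S`: a maximal run of same-column arcs keeps its direction and climbs (descends) one row per arc.
* ★ `YBWalk.exists_vrun_start` / `YBWalk.exists_vrun_end`: the vertical run through a given arc starts with a HORIZONTAL entry
  (`W`/`E`) — when the first arc lies in another column — and ends with a horizontal exit or at the walk's last arc, with the row
  bookkeeping in either direction.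

Elementary (the tiling; [GlazmanManolescu2019, §1, Fig. 1: consecutive arcs lie in adjacent rhombi]).
-/

noncomputable section

namespace Literature.Probability.RandomPlanarGeometry.SAW.YangBaxter

open Real

namespace YBWalk

variable {D : Set Face} {a z : MidEdge} (γ : YBWalk D a z)

/-! ## Vertical steps stay in the column -/

/-- An arc entering through a SLANTED side (`S` or `N`) is preceded by an arc in the SAME COLUMN. [cite: GlazmanManolescu2019, §1, Fig. 1] -/
theorem fc_pred_col_of_sIn_SN {i : ℕ} (hi : i < γ.arcs.length) (h1 : 1 ≤ i) (hSN : γ.sIn i = .S ∨ γ.sIn i = .N) :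
    (γ.fc (i - 1)).1 = (γ.fc i).1 := by
  rcases hSN with hS | hN
  · rw [γ.fc_pred_eq_of_sIn_S hi h1 hS]
  · rw [γ.fc_pred_eq_of_sIn_N hi h1 hN]

/-- An arc leaving through a SLANTED side is followed by an arc in the SAME COLUMN. [cite: GlazmanManolescu2019, §1, Fig. 1] -/
theorem fc_succ_col_of_sOut_SN {i : ℕ} (hi : i + 1 < γ.arcs.length) (hSN : γ.sOut i = .S ∨ γ.sOut i = .N) :
    (γ.fc (i + 1)).1 = (γ.fc i).1 := by
  rcases hSN with hS | hN
  · rw [γ.fc_succ_eq_of_sOut_S hi hS]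
  · rw [γ.fc_succ_eq_of_sOut_N hi hN]

/-- Two consecutive arcs in the same column are joined through a slanted side: the first leaves through `S` or `N`.
[cite: GlazmanManolescu2019, §1, Fig. 1] -/
theorem sOut_SN_of_col_eq {i : ℕ} (hi : i + 1 < γ.arcs.length) (h : (γ.fc (i + 1)).1 = (γ.fc i).1) :
    γ.sOut i = .S ∨ γ.sOut i = .N := by
  cases hs : γ.sOut i
  · have e := γ.fc_succ_eq_of_sOut_W hi hs; rw [e.1] at h; simp only at h; omega
  · have e := γ.fc_succ_eq_of_sOut_E hi hs; rw [e.1] at h; simp only at h; omega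
  · exact Or.inl rfl
  · exact Or.inr rfl

/-- Two consecutive arcs in the same column: the second enters through `S` or `N`. [cite: GlazmanManolescu2019, §1, Fig. 1] -/
theorem sIn_SN_of_col_eq {i : ℕ} (hi : i + 1 < γ.arcs.length) (h : (γ.fc (i + 1)).1 = (γ.fc i).1) :
    γ.sIn (i + 1) = .S ∨ γ.sIn (i + 1) = .N := by
  -- a horizontal entry would put the predecessor in the same row, hence in the same plaquette
  have key : (γ.sIn (i + 1) = .W ∨ γ.sIn (i + 1) = .E) → False := fun hWE => by
    have e := γ.fc_pred_row_of_sIn_WE hi (by omega) hWE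
    rw [show i + 1 - 1 = i by omega] at e
    exact γ.fc_succ_ne hi (Prod.ext h.symm e)
  cases hs : γ.sIn (i + 1)
  · exact (key (Or.inl hs)).elim
  · exact (key (Or.inr hs)).elim
  · exact Or.inl rfl
  · exact Or.inr rfl

/-! ## Vertical runs keep their direction -/

/-- ★ **A RUN HEADING NORTH KEEPS HEADING NORTH**: if the arcs `i, …, i+n` lie in one column and the arc `i` leaves through `N`, then every
arc `i ≤ k < i + n` leaves through `N` and the plaquette of the arc `i + n` lies `n` rows higher. [cite: GlazmanManolescu2019, §1, Fig. 1] -/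
theorem run_N {i : ℕ} (hN : γ.sOut i = .N) : ∀ n : ℕ, i + n < γ.arcs.length →
    (∀ k, i ≤ k → k ≤ i + n → (γ.fc k).1 = (γ.fc i).1) →
    (∀ k, i ≤ k → k < i + n → γ.sOut k = .N) ∧ (γ.fc (i + n)).2 = (γ.fc i).2 + n
  | 0, _, _ => ⟨fun k h1 h2 => by omega, by simp⟩
  | n + 1, hlen, hcol => by
      obtain ⟨hall, hy⟩ := run_N hN n (by omega) (fun k h1 h2 => hcol k h1 (by omega))
      have hNn : γ.sOut (i + n) = .N := by
        rcases Nat.eq_zero_or_pos n with rfl | hn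
        · simpa using hN
        · have hprev := hall (i + n - 1) (by omega) (by omega)
          have hin : γ.sIn (i + n) = .S := by
            have e := γ.fc_succ_eq_of_sOut_N (i := i + n - 1) (by omega) hprev
            rw [show i + n - 1 + 1 = i + n by omega] at e
            -- the arc `i+n` is entered from below: its `S` side is the `N` side of the predecessor
            obtain ⟨hinS, -⟩ := γ.side_sIn_eq_nth (show i + n < γ.arcs.length by omega)
            obtain ⟨-, houtP⟩ := γ.side_sIn_eq_nth (show i + n - 1 < γ.arcs.length by omega)
            rw [show i + n - 1 + 1 = i + n by omega] at houtP
            rw [hprev] at houtP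
            have ee : (γ.fc (i + n)).side (γ.sIn (i + n)) = .slant (γ.fc (i + n)).1 (γ.fc (i + n)).2 := by
              rw [hinS, ← houtP, e]; obtain ⟨k, j⟩ := γ.fc (i + n - 1); simp [Face.side]
            rcases eq_of_side_eq_slant ee with ⟨-, hs⟩ | ⟨h2, -⟩
            · exact hs
            · exfalso; have := congrArg Prod.snd h2; simp only at this; omega
          have hne := γ.sIn_ne_sOut (show i + n < γ.arcs.length by omega)
          rw [hin] at hne
          have hc := (hcol (i + n + 1) (by omega) (by omega)).trans (hcol (i + n) (by omega) (by omega)).symm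
          rcases γ.sOut_SN_of_col_eq (by omega) hc with e | e
          · exact absurd e.symm hne
          · exact e
      refine ⟨fun k h1 h2 => ?_, ?_⟩
      · rcases Nat.lt_or_ge k (i + n) with hk | hk
        · exact hall k h1 hk
        · rw [show k = i + n by omega]; exact hNn
      · have hfc := γ.fc_succ_eq_of_sOut_N (by omega) hNn
        rw [show i + (n + 1) = i + n + 1 by omega, hfc]
        push_cast
        omega

/-- ★ **A RUN HEADING SOUTH KEEPS HEADING SOUTH** (the mirror statement). [cite: GlazmanManolescu2019, §1, Fig. 1] -/
theorem run_S {i : ℕ} (hS : γ.sOut i = .S) : ∀ n : ℕ, i + n < γ.arcs.length →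
    (∀ k, i ≤ k → k ≤ i + n → (γ.fc k).1 = (γ.fc i).1) →
    (∀ k, i ≤ k → k < i + n → γ.sOut k = .S) ∧ (γ.fc (i + n)).2 + n = (γ.fc i).2
  | 0, _, _ => ⟨fun k h1 h2 => by omega, by simp⟩
  | n + 1, hlen, hcol => by
      obtain ⟨hall, hy⟩ := run_S hS n (by omega) (fun k h1 h2 => hcol k h1 (by omega))
      have hSn : γ.sOut (i + n) = .S := by
        rcases Nat.eq_zero_or_pos n with rfl | hn
        · simpa using hS
        · have hprev := hall (i + n - 1) (by omega) (by omega)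
          have hin : γ.sIn (i + n) = .N := by
            have e := γ.fc_succ_eq_of_sOut_S (i := i + n - 1) (by omega) hprev
            rw [show i + n - 1 + 1 = i + n by omega] at e
            obtain ⟨hinS, -⟩ := γ.side_sIn_eq_nth (show i + n < γ.arcs.length by omega)
            obtain ⟨-, houtP⟩ := γ.side_sIn_eq_nth (show i + n - 1 < γ.arcs.length by omega)
            rw [show i + n - 1 + 1 = i + n by omega] at houtP
            rw [hprev] at houtP
            have ee : (γ.fc (i + n)).side (γ.sIn (i + n)) = .slant (γ.fc (i + n)).1 ((γ.fc (i + n)).2 + 1) := by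
              rw [hinS, ← houtP, e]; obtain ⟨k, j⟩ := γ.fc (i + n - 1); simp [Face.side]
            rcases eq_of_side_eq_slant ee with ⟨h2, -⟩ | ⟨-, hs⟩
            · exfalso; have := congrArg Prod.snd h2; simp only at this; omega
            · exact hs
          have hne := γ.sIn_ne_sOut (show i + n < γ.arcs.length by omega)
          rw [hin] at hne
          have hc := (hcol (i + n + 1) (by omega) (by omega)).trans (hcol (i + n) (by omega) (by omega)).symm
          rcases γ.sOut_SN_of_col_eq (by omega) hc with e | e
          · exact e
          · exact absurd e.symm hne
      refine ⟨fun k h1 h2 => ?_, ?_⟩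
      · rcases Nat.lt_or_ge k (i + n) with hk | hk
        · exact hall k h1 hk
        · rw [show k = i + n by omega]; exact hSn
      · have hfc := γ.fc_succ_eq_of_sOut_S (by omega) hSn
        rw [show i + (n + 1) = i + n + 1 by omega, hfc]
        push_cast
        omega

/-! ## The vertical run through a given arc -/

/-- ★ **THE START OF A VERTICAL RUN**: the maximal run of same-column arcs ending at the arc `m` starts at an index `1 ≤ j₀ ≤ m` (when
the first arc of the walk lies in another column) with an arc entering HORIZONTALLY (`W`/`E`), and the run heads south — every arc before
`m` leaves through `S`, the plaquette of `m` lies `m − j₀` rows below that of `j₀` — or north. [cite: GlazmanManolescu2019, §1, Fig. 1] -/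
theorem exists_vrun_start {m : ℕ} (hm : m < γ.arcs.length) (h0 : (γ.fc 0).1 ≠ (γ.fc m).1) :
    ∃ j₀, 1 ≤ j₀ ∧ j₀ ≤ m ∧ (∀ k, j₀ ≤ k → k ≤ m → (γ.fc k).1 = (γ.fc m).1) ∧ (γ.fc (j₀ - 1)).1 ≠ (γ.fc m).1 ∧
      (γ.sIn j₀ = .W ∨ γ.sIn j₀ = .E) ∧
      (((∀ k, j₀ ≤ k → k < m → γ.sOut k = .S) ∧ (γ.fc m).2 + (m - j₀ : ℕ) = (γ.fc j₀).2) ∨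
        ((∀ k, j₀ ≤ k → k < m → γ.sOut k = .N) ∧ (γ.fc m).2 = (γ.fc j₀).2 + (m - j₀ : ℕ))) := by
  classical
  have hex : ∃ j, ∀ k, j ≤ k → k ≤ m → (γ.fc k).1 = (γ.fc m).1 := ⟨m, fun k h1 h2 => by rw [show k = m by omega]⟩
  obtain hspec := Nat.find_spec hex
  set j₀ := Nat.find hex with hj₀
  have hj₀m : j₀ ≤ m := Nat.find_min' hex (fun k h1 h2 => by rw [show k = m by omega])
  have hj₀1 : 1 ≤ j₀ := by
    by_contra hlt
    have e0 : j₀ = 0 := by omega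
    exact h0 (hspec 0 (by omega) (by omega))
  have hprev : (γ.fc (j₀ - 1)).1 ≠ (γ.fc m).1 := by
    intro e
    have := Nat.find_min hex (m := j₀ - 1) (by omega)
    exact this fun k h1 h2 => by
      rcases Nat.lt_or_ge k j₀ with hk | hk
      · rw [show k = j₀ - 1 by omega]; exact e
      · exact hspec k hk h2
  have hj₀lt : j₀ < γ.arcs.length := by omega
  -- the entry is horizontal: a vertical entry would put the predecessor in the same column
  have hSN : γ.sIn j₀ = .W ∨ γ.sIn j₀ = .E := by
    have hrow := hspec j₀ le_rfl hj₀m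
    cases hs : γ.sIn j₀
    · exact Or.inl rfl
    · exact Or.inr rfl
    · exact absurd ((γ.fc_pred_col_of_sIn_SN hj₀lt hj₀1 (Or.inl hs)).trans hrow) hprev
    · exact absurd ((γ.fc_pred_col_of_sIn_SN hj₀lt hj₀1 (Or.inr hs)).trans hrow) hprev
  refine ⟨j₀, hj₀1, hj₀m, hspec, hprev, hSN, ?_⟩
  -- direction
  rcases Nat.lt_or_ge j₀ m with hlt | hge
  · have hrowrun : ∀ k, j₀ ≤ k → k ≤ j₀ + (m - j₀) → (γ.fc k).1 = (γ.fc j₀).1 := fun k h1 h2 =>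
      (hspec k h1 (by omega)).trans (hspec j₀ le_rfl hj₀m).symm
    have hr : (γ.fc (j₀ + 1)).1 = (γ.fc j₀).1 := (hspec (j₀ + 1) (by omega) (by omega)).trans (hspec j₀ le_rfl hj₀m).symm
    rcases γ.sOut_SN_of_col_eq (by omega) hr with hW | hE
    · left
      obtain ⟨hall, hx⟩ := γ.run_S hW (m - j₀) (by rw [show j₀ + (m - j₀) = m by omega]; exact hm) hrowrun
      rw [show j₀ + (m - j₀) = m by omega] at hall hx
      exact ⟨hall, hx⟩
    · right
      obtain ⟨hall, hx⟩ := γ.run_N hE (m - j₀) (by rw [show j₀ + (m - j₀) = m by omega]; exact hm) hrowrun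
      rw [show j₀ + (m - j₀) = m by omega] at hall hx
      exact ⟨hall, hx⟩
  · have e : j₀ = m := le_antisymm hj₀m hge
    left
    refine ⟨fun k h1 h2 => by omega, ?_⟩
    rw [e]; simp

/-- ★ **THE END OF A VERTICAL RUN**: the maximal run of same-column arcs starting at the arc `m` ends at an index `j₁ ≥ m` which is
either the walk's LAST arc or an arc leaving HORIZONTALLY (`W`/`E`) into another column; the run heads south (every arc from `m` to
before `j₁` leaves through `S`, the plaquette of `j₁` lies `j₁ − m` rows lower) or north. [cite: GlazmanManolescu2019, §1, Fig. 1] -/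
theorem exists_vrun_end {m : ℕ} (hm : m < γ.arcs.length) :
    ∃ j₁, m ≤ j₁ ∧ j₁ < γ.arcs.length ∧ (∀ k, m ≤ k → k ≤ j₁ → (γ.fc k).1 = (γ.fc m).1) ∧
      (j₁ + 1 = γ.arcs.length ∨ (j₁ + 1 < γ.arcs.length ∧ (γ.fc (j₁ + 1)).1 ≠ (γ.fc m).1 ∧ (γ.sOut j₁ = .W ∨ γ.sOut j₁ = .E))) ∧
      (((∀ k, m ≤ k → k < j₁ → γ.sOut k = .S) ∧ (γ.fc j₁).2 + (j₁ - m : ℕ) = (γ.fc m).2) ∨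
        ((∀ k, m ≤ k → k < j₁ → γ.sOut k = .N) ∧ (γ.fc j₁).2 = (γ.fc m).2 + (j₁ - m : ℕ))) := by
  classical
  -- the first index `j ≥ m` at which the run stops
  have hex : ∃ n, m + n < γ.arcs.length ∧ (m + n + 1 = γ.arcs.length ∨ (m + n + 1 < γ.arcs.length ∧ (γ.fc (m + n + 1)).1 ≠ (γ.fc m).1)) :=
    by
    by_contra hne
    push Not at hne
    -- then every arc after `m` lies in the column of `m` and the walk never ends: induction reaches the last arc
    have key : ∀ n, m + n < γ.arcs.length ∧ (γ.fc (m + n)).1 = (γ.fc m).1 := by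
      intro n
      induction n with
      | zero => exact ⟨by simpa using hm, by simp⟩
      | succ n ih =>
        obtain ⟨h1, -⟩ := ih
        have h3 := hne n h1
        refine ⟨by omega, ?_⟩
        rw [show m + (n + 1) = m + n + 1 by omega]
        exact h3.2 (by omega)
    have := (key γ.arcs.length).1; omega
  obtain ⟨hlen, hstop⟩ := Nat.find_spec hex
  set n₁ := Nat.find hex with hn₁
  have hmin : ∀ n < n₁, ¬(m + n < γ.arcs.length ∧ (m + n + 1 = γ.arcs.length ∨
      (m + n + 1 < γ.arcs.length ∧ (γ.fc (m + n + 1)).1 ≠ (γ.fc m).1))) := fun n hn => Nat.find_min hex hn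
  -- all arcs `m … m + n₁` lie in the column of `m`
  have hrowrun : ∀ k, m ≤ k → k ≤ m + n₁ → (γ.fc k).1 = (γ.fc m).1 := by
    intro k h1 h2
    induction k, h1 using Nat.le_induction with
    | base => rfl
    | succ k hk ih =>
      have ih' := ih (by omega)
      have hk' := hmin (k - m) (by omega)
      rw [show m + (k - m) = k by omega] at hk'
      push Not at hk'
      exact (hk' (by omega)).2 (by omega)
  refine ⟨m + n₁, by omega, hlen, hrowrun, ?_, ?_⟩
  · rcases hstop with h | ⟨h1, h2⟩
    · exact Or.inl h
    · refine Or.inr ⟨h1, h2, ?_⟩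
      have hrow := hrowrun (m + n₁) (by omega) le_rfl
      cases hs : γ.sOut (m + n₁)
      · exact Or.inl rfl
      · exact Or.inr rfl
      · exact absurd ((γ.fc_succ_col_of_sOut_SN h1 (Or.inl hs)).trans hrow) h2
      · exact absurd ((γ.fc_succ_col_of_sOut_SN h1 (Or.inr hs)).trans hrow) h2
  · rcases Nat.eq_zero_or_pos n₁ with hz | hpos
    · left
      refine ⟨fun k h1 h2 => by omega, ?_⟩
      rw [hz]; simp
    · have hr : (γ.fc (m + 1)).1 = (γ.fc m).1 := hrowrun (m + 1) (by omega) (by omega)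
      rcases γ.sOut_SN_of_col_eq (by omega) hr with hW | hE
      · left
        obtain ⟨hall, hx⟩ := γ.run_S hW n₁ hlen hrowrun
        rw [show m + n₁ - m = n₁ by omega]
        exact ⟨hall, hx⟩
      · right
        obtain ⟨hall, hx⟩ := γ.run_N hE n₁ hlen hrowrun
        rw [show m + n₁ - m = n₁ by omega]
        exact ⟨hall, hx⟩

end YBWalk

end Literature.Probability.RandomPlanarGeometry.SAW.YangBaxter
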